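import Mathlib
import Summits.Schanuel.Schanuel.Theses.RigidCore
import Summits.Schanuel.Schanuel.Theorems.AclSubsetLogFreeCore.Negative.ExpAclField

/-!
# Crux `MinimalCounterexampleInAcl` (stmt-Schanuel-0969), line `kernel-arithmetic-selection` — stub 1: ℚ-linear independence of an `n`-tuple is `∅`-definable in `ℂ_exp`

Support theorem for the crux (S*) `RigidCore.MinimalCounterexampleInAcl`: for every `n`, the set
`{v : ℂⁿ | v is ℚ-linearly independent}` is `∅`-definable in `ℂ_exp = (ℂ, +, ·, −, 0, 1, exp)`
(language `Language.expRing`).  The point is that `ℂ_exp` contains true arithmetic: the kernel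
stabiliser `ℤ = intSet = {m | ∀ z, e^z = 1 → e^{mz} = 1}` is `∅`-definable (KMO 2012 §2.2; tree:
`mem_intSet_iff`, `definable_mem_intSet`), so

  `v` ℚ-linearly DEPENDENT ⟺ `∃ m ∈ ℤⁿ, m ≠ 0, Σ mᵢ vᵢ = 0`

is ONE `∅`-formula (`n` existential quantifiers, `Set.Definable.exists_of_finite`), and the
independent tuples are its complement.  The equivalence "no rational relation ⟺ no integer
relation" is Mathlib's `LinearIndependent.iff_fractionRing ℤ ℚ` (clearing denominators) followed by
`Fintype.linearIndependent_iff` over `ℤ`.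

Main result: `stub_linearIndependentDefinable` (registered stub 1 of the line skeleton, verbatim).
Helpers: `definable_intRelation` (the relation set in the variables `(v, m) : Fin n ⊕ Fin n → ℂ`
is `∅`-definable) and `linearIndependent_iff_not_exists_intRelation`.

## References

* [KirbyMacintyreOnshuus2012] J. Kirby, A. Macintyre, A. Onshuus, *The algebraic numbers definable
  in various exponential fields*, J. Inst. Math. Jussieu 11 (2012) 825–834, arXiv:1101.4224, §2.2
  (`ℤ` is parameter-free definable in any exponential field with cyclic kernel).
* [Marker2002] D. Marker, *Model Theory: An Introduction*, Springer GTM 217, §1.3 (definable sets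
  are closed under boolean combinations and projections).
-/

noncomputable section

set_option linter.dupNamespace false

open FirstOrder FirstOrder.Language Set
open Literature.ModelTheory.ExponentialFields
open Summit.Schanuel.Schanuel.Theorems.AclSubsetLogFreeCore.Negative

namespace Summit.Schanuel.Schanuel.Cruxes.MinimalCounterexampleInAcl.KernelArithmeticSelection

/-- The integer-relation set in the variables `w = (v, m) : Fin n ⊕ Fin n → ℂ` — `m ∈ ℤⁿ`,
`m ≠ 0`, `Σ mᵢ vᵢ = 0` — is `∅`-definable in `ℂ_exp` (`ℤ = intSet` is an `∅`-formula, the sum is an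
integer polynomial map). [cite: KirbyMacintyreOnshuus2012, §2.2] -/
theorem definable_intRelation (n : ℕ) :
    (∅ : Set ℂ).Definable Language.expRing
      {w : Fin n ⊕ Fin n → ℂ | (∀ i, w (Sum.inr i) ∈ intSet) ∧ ¬ (∀ i, w (Sum.inr i) = 0) ∧
        ∑ i, w (Sum.inr i) * w (Sum.inl i) = 0} := by
  refine definable_setOf_and_params ?_ (definable_setOf_and_params ?_ ?_)
  · have e : {w : Fin n ⊕ Fin n → ℂ | ∀ i, w (Sum.inr i) ∈ intSet} =
        ⋂ i, {w | w (Sum.inr i) ∈ intSet} := by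
      ext w; simp
    rw [e]
    exact Set.definable_iInter_of_finite fun i =>
      definable_mem_intSet (definableFun_proj_params _)
  · refine definable_setOf_not_params ?_
    have e : {w : Fin n ⊕ Fin n → ℂ | ∀ i, w (Sum.inr i) = 0} =
        ⋂ i, {w | w (Sum.inr i) = 0} := by
      ext w; simp
    rw [e]
    exact Set.definable_iInter_of_finite fun i =>
      definable_setOf_eq_params (definableFun_proj_params _) definableFun_zero'
  · let Q : MvPolynomial (Fin n ⊕ Fin n) ℤ :=
      ∑ i : Fin n, MvPolynomial.X (Sum.inr i) * MvPolynomial.X (Sum.inl i)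
    have hQ : (fun w : Fin n ⊕ Fin n → ℂ => ∑ i, w (Sum.inr i) * w (Sum.inl i)) =
        fun w => MvPolynomial.aeval w Q := by
      funext w; simp [Q, map_sum]
    have hf := definableFun_mvPolynomial_aeval' Q
    rw [← hQ] at hf
    exact definable_setOf_eq_params hf definableFun_zero'

/-- A finite tuple `v : Fin n → ℂ` is ℚ-linearly independent iff it has no non-trivial relation
with coefficients in `ℤ = intSet ⊆ ℂ` (clearing denominators: `LinearIndependent.iff_fractionRing`).
[folklore] -/
theorem linearIndependent_iff_not_exists_intRelation {n : ℕ} (v : Fin n → ℂ) :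
    LinearIndependent ℚ v ↔
      ¬ ∃ m : Fin n → ℂ, (∀ i, m i ∈ intSet) ∧ ¬ (∀ i, m i = 0) ∧ ∑ i, m i * v i = 0 := by
  rw [← LinearIndependent.iff_fractionRing ℤ ℚ, Fintype.linearIndependent_iff]
  constructor
  · rintro h ⟨m, hm, hm0, hsum⟩
    choose k hk using fun i => mem_intSet_iff.1 (hm i)
    obtain rfl : m = fun i => (k i : ℂ) := funext hk
    refine hm0 fun i => ?_
    have hk0 : k i = 0 := h k (by simpa [zsmul_eq_mul] using hsum) i
    simp [hk0]
  · rintro h g hg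
    by_contra hne
    refine h ⟨fun i => (g i : ℂ), fun i => mem_intSet_iff.2 ⟨g i, rfl⟩, fun h0 => hne fun i => ?_, ?_⟩
    · have h0i : ((g i : ℤ) : ℂ) = 0 := h0 i
      exact_mod_cast h0i
    · simpa [zsmul_eq_mul] using hg

/-- **Stub 1 — ℚ-linear independence is `∅`-definable in `ℂ_exp`.** `v` is ℚ-linearly
independent iff `¬ ∃ m ∈ ℤⁿ ∖ 0, Σ mᵢ vᵢ = 0`, and `m ∈ ℤ` is the `∅`-formula
`∀ z (e^z = 1 → e^{mz} = 1)` (`definable_mem_intSet`, `mem_intSet_iff`); `n` existential quantifiers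
over the `mᵢ` (`Set.Definable.exists_of_finite`) and one complement (`Set.Definable.compl`).
[cite: KirbyMacintyreOnshuus2012, §2.2] -/
theorem stub_linearIndependentDefinable : ∀ n : ℕ, (∅ : Set ℂ).Definable Literature.ModelTheory.ExponentialFields.Language.expRing {v : Fin n → ℂ | LinearIndependent ℚ v} := by
  intro n
  have h := (definable_intRelation n).exists_of_finite.compl
  convert h using 1
  ext v
  rw [mem_setOf_eq, linearIndependent_iff_not_exists_intRelation v, mem_compl_iff, mem_setOf_eq]
  simp only [mem_setOf_eq, Sum.elim_inl, Sum.elim_inr]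

end Summit.Schanuel.Schanuel.Cruxes.MinimalCounterexampleInAcl.KernelArithmeticSelection
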